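import Summits.CriticalPhenomena.PercolationContinuityZ3.Theorems.PercNearOneGluingNoHeavyLowerTailAntitheticPeelTools
import HarnessLib

/-!
# `NoHeavyLowerTail` (stmt-CriticalPhenomena-4575) — antithetic cluster pairs: the PEELING IDENTITY and "BIC ⟹ SC"
# (prim-hp-2 gen 31/36; MEMO-gen31 §1a–c PROPOSITION, MEMO-gen36 §6)

Support file (`--supports stmt-CriticalPhenomena-4575`, hull-port prover `prim-hp-2`, gen 36).  No definitions, no named facts, no sorries;
standard axioms.  Notation of `…AntitheticPeelTools`: `T_E(R,X) = Peel.tsum F G E s R X = Σ_{ω ∈ tset E s R X} Δ_E(ω)`, the antithetic sum over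
the colourings in which no vertex of `R` is joined to `s` in both colours and no vertex of `X` in either; `T_E(R,∅) = BIC_E(R)` and
`T_E(∅,X) = SC(E,X)` (the antithetic BHK sum with sink set `X`).

* `Antithetic.Peel.peel_identity` — PEELING A SINK (MEMO-gen31 §1a–c): for `x ∈ X`, `x ≠ s`, with `E' = E ∖ {pairs at x}` and `N` the set of
  `E`-neighbours of `x`:  `2^{|N|} · T_E(R,X) = Σ_{A ⊆ N} T_{E'}(R ∪ (N∖A), (X∖{x}) ∪ A)`.  (Sum out the colours of the edges `xu`: `x` is
  unreached iff every red `xu` has `u ∉ W` and every blue `xu` has `u ∉ W'` in `E'`; per neighbour `1[u∉W] + 1[u∉W'] = 1[u∉W∪W'] +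
  1[u∉W∩W']`; expand the product.)  Valid for ANY functional in place of `Δ`.
* `Antithetic.Peel.tsum_nonneg_of_bic` — the PROPOSITION of MEMO-gen31 §1c as a tree theorem: if `BIC_{E'}(R') ≥ 0` for every `E' ⊆ E` and
  every `R' ∌ s`, then `T_E(R,X) ≥ 0` for all `R ∌ s` and all `X`.
* `Antithetic.sc_nonneg_of_bic` — in particular CONJECTURE BIC (all edge subsets of `E`, all `R`) implies the antithetic BHK inequality
  SC(E,X) ≥ 0 for every sink set `X`, stated without the `Peel` bookkeeping.
[cite: VandenbergHaggstromKahn2005, Thm. 1.3 (p. 6), §1 p. 3 (open cluster `C_s`)]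
-/

noncomputable section

namespace Summit.CriticalPhenomena.PercolationContinuityZ3.Theorems

open Literature.Probability.Percolation
open scoped Classical symmDiff

namespace Antithetic

namespace Peel

variable {V : Type*} [Fintype V]

/-- `T_E(R,X) = 0` when `s ∈ R` (the source is always in both clusters). [this work] -/
theorem tsum_eq_zero_of_mem_R (F G : Set (Sym2 V) → ℝ) (E : Set (Sym2 V)) (s : V) {R : Set V} (X : Set V) (hs : s ∈ R) :
    tsum F G E s R X = 0 := by
  rw [tsum]
  refine Finset.sum_eq_zero fun ω hω => ?_
  rw [mem_tset] at hω
  exact absurd ⟨SimpleGraph.Reachable.refl s, SimpleGraph.Reachable.refl s⟩ (hω.1 s hs)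

/-- `T_E(R,X) = 0` when `s ∈ X`. [this work] -/
theorem tsum_eq_zero_of_mem_X (F G : Set (Sym2 V) → ℝ) (E : Set (Sym2 V)) (s : V) (R : Set V) {X : Set V} (hs : s ∈ X) :
    tsum F G E s R X = 0 := by
  rw [tsum]
  refine Finset.sum_eq_zero fun ω hω => ?_
  rw [mem_tset] at hω
  exact absurd (SimpleGraph.Reachable.refl s) (hω.2 s hs).1

omit [Fintype V] in
/-- Deleting the pairs at `x` from `ω ∩ E` is intersecting `ω` with `E ∖ {pairs at x}`. [folklore] -/
theorem inter_sdiff_at (ω E : Set (Sym2 V)) (x : V) : (ω ∩ E) \ {e | x ∈ e} = ω ∩ (E \ {e | x ∈ e}) := by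
  ext e
  simp only [Set.mem_sdiff, Set.mem_inter_iff, Set.mem_setOf_eq]
  tauto

omit [Fintype V] in
/-- The slab of `A ⊆ N` in terms of the red-neighbour set. [folklore] -/
theorem slab_iff_filter_eq (x : V) (N A : Finset V) (hA : A ⊆ N) (ω : Set (Sym2 V)) :
    (∀ u ∈ N, s(x, u) ∈ ω ↔ u ∈ A) ↔ (N.filter fun u => s(x, u) ∈ ω) = A := by
  rw [Finset.ext_iff]
  constructor
  · intro h u
    rw [Finset.mem_filter]
    exact ⟨fun hm => (h u hm.1).1 hm.2, fun hu => ⟨hA hu, (h u (hA hu)).2 hu⟩⟩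
  · intro h u hu
    have := h u
    rw [Finset.mem_filter] at this
    exact ⟨fun hm => this.1 ⟨hu, hm⟩, fun hu' => (this.2 hu').2⟩

/-- **Peeling one sink, pointwise.**  `x ∈ X`, `x ≠ s`, `E' = E ∖ {pairs at x}`, `N` the `E`-neighbours of `x`, `ω` in the slab of `A ⊆ N`
(`xu ∈ ω ↔ u ∈ A`).  Then `ω ∈ tset E s R X` iff `ω ∈ tset E' s R (X ∖ {x})`, no `u ∈ A` is red-reached and no `u ∈ N ∖ A` is blue-reached in
`E'`; and in that case `Δ_E(ω) = Δ_{E'}(ω)`. [this work] -/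
theorem mem_tset_iff_of_slab (F G : Set (Sym2 V) → ℝ) (E : Set (Sym2 V)) (s x : V) (hxs : x ≠ s) (R X : Set V) (hxX : x ∈ X)
    (A : Finset V) (hA : A ⊆ Finset.univ.filter fun u => s(x, u) ∈ E ∧ u ≠ x) (ω : Set (Sym2 V))
    (hslab : ∀ u ∈ (Finset.univ.filter fun u => s(x, u) ∈ E ∧ u ≠ x), s(x, u) ∈ ω ↔ u ∈ A) :
    (ω ∈ tset E s R X ↔
      ω ∈ tset (E \ {e | x ∈ e}) s R (X \ {x}) ∧
        (∀ u ∈ A, ¬ (openGraph (ω ∩ (E \ {e | x ∈ e}))).Reachable s u) ∧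
        (∀ u ∈ (Finset.univ.filter fun u => s(x, u) ∈ E ∧ u ≠ x) \ A,
          ¬ (openGraph (ωᶜ ∩ (E \ {e | x ∈ e}))).Reachable s u)) ∧
    (ω ∈ tset E s R X → delta F G E s ω = delta F G (E \ {e | x ∈ e}) s ω) := by
  set E' := E \ {e | x ∈ e} with hE'
  set N := Finset.univ.filter fun u => s(x, u) ∈ E ∧ u ≠ x with hN
  have hmemN : ∀ u, u ∈ N ↔ s(x, u) ∈ E ∧ u ≠ x := fun u => by rw [hN, Finset.mem_filter]; simp
  have h1 : (ω ∩ E) \ {e | x ∈ e} = ω ∩ E' := inter_sdiff_at ω E x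
  have h2 : (ωᶜ ∩ E) \ {e | x ∈ e} = ωᶜ ∩ E' := inter_sdiff_at ωᶜ E x
  have key_red : ¬ (openGraph (ω ∩ E)).Reachable s x ↔ ∀ u ∈ A, ¬ (openGraph (ω ∩ E')).Reachable s u := by
    rw [not_reachable_iff_nbrs (ω ∩ E) s x hxs, h1]
    constructor
    · intro h u hu
      have huN := (hmemN u).1 (hA hu)
      exact h u ⟨(hslab u (hA hu)).2 hu, huN.1⟩ huN.2
    · intro h u hxu hux
      have huN : u ∈ N := (hmemN u).2 ⟨hxu.2, hux⟩
      exact h u ((hslab u huN).1 hxu.1)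
  have key_blue : ¬ (openGraph (ωᶜ ∩ E)).Reachable s x ↔ ∀ u ∈ N \ A, ¬ (openGraph (ωᶜ ∩ E')).Reachable s u := by
    rw [not_reachable_iff_nbrs (ωᶜ ∩ E) s x hxs, h2]
    constructor
    · intro h u hu
      rw [Finset.mem_sdiff] at hu
      have huN := (hmemN u).1 hu.1
      exact h u ⟨fun hm => hu.2 ((hslab u hu.1).1 hm), huN.1⟩ huN.2
    · intro h u hxu hux
      have huN : u ∈ N := (hmemN u).2 ⟨hxu.2, hux⟩
      have huA : u ∉ A := fun h' => hxu.1 ((hslab u huN).2 h')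
      exact h u (Finset.mem_sdiff.2 ⟨huN, huA⟩)
  have hred : ¬ (openGraph (ω ∩ E)).Reachable s x → ∀ v, (openGraph (ω ∩ E')).Reachable s v ↔ (openGraph (ω ∩ E)).Reachable s v :=
    fun hx v => by rw [← h1]; exact reachable_sdiff_iff _ s x hx v
  have hblue : ¬ (openGraph (ωᶜ ∩ E)).Reachable s x →
      ∀ v, (openGraph (ωᶜ ∩ E')).Reachable s v ↔ (openGraph (ωᶜ ∩ E)).Reachable s v :=
    fun hx v => by rw [← h2]; exact reachable_sdiff_iff _ s x hx v
  constructor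
  · constructor
    · intro hω
      rw [mem_tset] at hω
      obtain ⟨hR, hX⟩ := hω
      have hx := hX x hxX
      refine ⟨?_, key_red.1 hx.1, key_blue.1 hx.2⟩
      rw [mem_tset]
      refine ⟨fun r hr => ?_, fun y hy => ?_⟩
      · rw [hred hx.1, hblue hx.2]; exact hR r hr
      · rw [hred hx.1, hblue hx.2]; exact hX y hy.1
    · rintro ⟨hω', hAred, hNA⟩
      have hxr := key_red.2 hAred
      have hxb := key_blue.2 hNA
      rw [mem_tset] at hω' ⊢
      refine ⟨fun r hr => ?_, fun y hy => ?_⟩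
      · rw [← hred hxr, ← hblue hxb]; exact hω'.1 r hr
      · by_cases hyx : y = x
        · subst hyx; exact ⟨hxr, hxb⟩
        · rw [← hred hxr, ← hblue hxb]; exact hω'.2 y ⟨hy, hyx⟩
  · intro hω
    rw [mem_tset] at hω
    have hx := hω.2 x hxX
    rw [delta, delta, ← h1, ← h2, openEdgeCluster_sdiff_eq _ s x hx.1, openEdgeCluster_sdiff_eq _ s x hx.2]

omit [Fintype V] in
/-- A reflection across pairs at `x` does not change the colouring away from `x`. [folklore] -/
theorem symmDiff_inter_sdiff_eq {ω D E : Set (Sym2 V)} {x : V} (hD : D ⊆ {e | x ∈ e}) :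
    (ω ∆ D) ∩ (E \ {e | x ∈ e}) = ω ∩ (E \ {e | x ∈ e}) := by
  ext e
  simp only [Set.mem_inter_iff, Set.mem_symmDiff, Set.mem_sdiff, Set.mem_setOf_eq]
  constructor
  · rintro ⟨h, hE, hx⟩
    have : e ∉ D := fun heD => hx (hD heD)
    exact ⟨by tauto, hE, hx⟩
  · rintro ⟨h, hE, hx⟩
    have : e ∉ D := fun heD => hx (hD heD)
    exact ⟨Or.inl ⟨h, this⟩, hE, hx⟩

omit [Fintype V] in
/-- The complement version. [folklore] -/
theorem compl_symmDiff_inter_sdiff_eq {ω D E : Set (Sym2 V)} {x : V} (hD : D ⊆ {e | x ∈ e}) :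
    (ω ∆ D)ᶜ ∩ (E \ {e | x ∈ e}) = ωᶜ ∩ (E \ {e | x ∈ e}) := by
  ext e
  simp only [Set.mem_inter_iff, Set.mem_compl_iff, Set.mem_symmDiff, Set.mem_sdiff, Set.mem_setOf_eq]
  constructor
  · rintro ⟨h, hE, hx⟩
    have : e ∉ D := fun heD => hx (hD heD)
    exact ⟨by tauto, hE, hx⟩
  · rintro ⟨h, hE, hx⟩
    have : e ∉ D := fun heD => hx (hD heD)
    exact ⟨by tauto, hE, hx⟩

omit [Fintype V] in
/-- Per-neighbour bookkeeping: `1[¬a] + 1[¬b] = 1[¬a ∧ ¬b] + 1[¬(a ∧ b)]`. [folklore] -/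
theorem ite_add_ite_eq (a b : Prop) :
    ((if ¬ a then (1 : ℝ) else 0) + if ¬ b then 1 else 0) = (if (¬ a ∧ ¬ b) then (1 : ℝ) else 0) + if ¬ (a ∧ b) then 1 else 0 := by
  by_cases ha : a <;> by_cases hb : b <;> simp [ha, hb]

/-- **THE PEELING IDENTITY** (MEMO-gen31 §1a–c).  For `x ∈ X`, `x ≠ s`, with `E' = E ∖ {pairs at x}` and `N` the `E`-neighbours of `x`:
`2^{|N|} · T_E(R,X) = Σ_{A ⊆ N} T_{E'}(R ∪ (N ∖ A), (X ∖ {x}) ∪ A)`. [this work] -/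
theorem peel_identity (F G : Set (Sym2 V) → ℝ) (E : Set (Sym2 V)) (s x : V) (hxs : x ≠ s) (R X : Set V) (hxX : x ∈ X) :
    (2 : ℝ) ^ (Finset.univ.filter fun u => s(x, u) ∈ E ∧ u ≠ x).card * tsum F G E s R X =
      ∑ A ∈ (Finset.univ.filter fun u => s(x, u) ∈ E ∧ u ≠ x).powerset,
        tsum F G (E \ {e | x ∈ e}) s (R ∪ ↑((Finset.univ.filter fun u => s(x, u) ∈ E ∧ u ≠ x) \ A)) ((X \ {x}) ∪ ↑A) := by
  set E' := E \ {e | x ∈ e} with hE'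
  set N := Finset.univ.filter fun u => s(x, u) ∈ E ∧ u ≠ x with hN
  set h : Finset V → Set (Sym2 V) → ℝ := fun A ω =>
    (if ω ∈ tset E' s R (X \ {x}) then delta F G E' s ω else 0) *
      ((∏ u ∈ A, if ¬ (openGraph (ω ∩ E')).Reachable s u then (1 : ℝ) else 0) *
        (∏ u ∈ N \ A, if ¬ (openGraph (ωᶜ ∩ E')).Reachable s u then (1 : ℝ) else 0)) with hh
  have step1 : ∀ ω : Set (Sym2 V), (if ω ∈ tset E s R X then delta F G E s ω else 0) =
      ∑ A ∈ N.powerset, if (∀ u ∈ N, s(x, u) ∈ ω ↔ u ∈ A) then h A ω else 0 := by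
    intro ω
    set A₀ := N.filter fun u => s(x, u) ∈ ω with hA₀
    have hA₀N : A₀ ⊆ N := Finset.filter_subset _ _
    rw [Finset.sum_eq_single_of_mem A₀ (Finset.mem_powerset.2 hA₀N)]
    · have hslab : ∀ u ∈ N, s(x, u) ∈ ω ↔ u ∈ A₀ := (slab_iff_filter_eq x N A₀ hA₀N ω).2 rfl
      rw [if_pos hslab]
      obtain ⟨hiff, hdelta⟩ := mem_tset_iff_of_slab F G E s x hxs R X hxX A₀ hA₀N ω hslab
      by_cases hω : ω ∈ tset E s R X
      · obtain ⟨h1', h2', h3'⟩ := hiff.1 hω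
        rw [if_pos hω, hh]
        dsimp only
        rw [Finset.prod_boole, Finset.prod_boole, if_pos h1', if_pos h2', if_pos h3', hdelta hω]
        ring
      · rw [if_neg hω, hh]
        dsimp only
        rw [Finset.prod_boole, Finset.prod_boole]
        by_cases h1' : ω ∈ tset E' s R (X \ {x})
        · rw [if_pos h1']
          by_cases h2' : ∀ u ∈ A₀, ¬ (openGraph (ω ∩ E')).Reachable s u
          · have h3' : ¬ ∀ u ∈ N \ A₀, ¬ (openGraph (ωᶜ ∩ E')).Reachable s u := fun h3' => hω (hiff.2 ⟨h1', h2', h3'⟩)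
            rw [if_neg h3']
            ring
          · rw [if_neg h2']
            ring
        · rw [if_neg h1']
          ring
    · intro A hA hne
      rw [if_neg]
      intro hslab
      exact hne ((slab_iff_filter_eq x N A (Finset.mem_powerset.1 hA) ω).1 hslab).symm
  have hinv : ∀ A, ∀ ω D : Set (Sym2 V), D ⊆ {e | ∃ u ∈ N, e = s(x, u)} → h A (ω ∆ D) = h A ω := by
    intro A ω D hD
    have hD' : D ⊆ {e | x ∈ e} := fun e he => by
      obtain ⟨u, -, rfl⟩ := hD he
      exact Sym2.mem_mk_left x u
    have e1 : (ω ∆ D) ∩ E' = ω ∩ E' := symmDiff_inter_sdiff_eq hD'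
    have e2 : (ω ∆ D)ᶜ ∩ E' = ωᶜ ∩ E' := compl_symmDiff_inter_sdiff_eq hD'
    have hmem : (ω ∆ D ∈ tset E' s R (X \ {x})) ↔ (ω ∈ tset E' s R (X \ {x})) := by
      rw [mem_tset, mem_tset, e1, e2]
    have hdel : delta F G E' s (ω ∆ D) = delta F G E' s ω := by
      rw [delta, delta, e1, e2]
    rw [hh]
    dsimp only
    simp only [hmem, hdel, e1, e2]
  have step2 : tsum F G E s R X = ∑ A ∈ N.powerset, (((2 : ℝ) ^ N.card)⁻¹ * ∑ ω, h A ω) := by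
    have e0 : tsum F G E s R X = ∑ ω : Set (Sym2 V), if ω ∈ tset E s R X then delta F G E s ω else 0 := by
      rw [tsum, Finset.sum_ite_mem, Finset.univ_inter]
    rw [e0, Finset.sum_congr rfl fun ω _ => step1 ω, Finset.sum_comm]
    refine Finset.sum_congr rfl fun A _ => ?_
    rw [← Finset.sum_filter, sum_eq_card_mul_sum_slab x N (h A) (hinv A) A]
    have h2 : (2 : ℝ) ^ N.card ≠ 0 := pow_ne_zero _ two_ne_zero
    field_simp
  have step3 : ∀ ω : Set (Sym2 V), ∑ A ∈ N.powerset, h A ω =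
      ∑ A ∈ N.powerset, if ω ∈ tset E' s (R ∪ ↑(N \ A)) ((X \ {x}) ∪ ↑A) then delta F G E' s ω else 0 := by
    intro ω
    have lhs : ∑ A ∈ N.powerset, h A ω = (if ω ∈ tset E' s R (X \ {x}) then delta F G E' s ω else 0) *
        ∏ u ∈ N, ((if ¬ (openGraph (ω ∩ E')).Reachable s u then (1 : ℝ) else 0) +
          (if ¬ (openGraph (ωᶜ ∩ E')).Reachable s u then (1 : ℝ) else 0)) := by
      rw [Finset.prod_add, Finset.mul_sum]
    have rhs : (∑ A ∈ N.powerset, if ω ∈ tset E' s (R ∪ ↑(N \ A)) ((X \ {x}) ∪ ↑A) then delta F G E' s ω else 0) =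
        (if ω ∈ tset E' s R (X \ {x}) then delta F G E' s ω else 0) *
        ∏ u ∈ N, ((if (¬ (openGraph (ω ∩ E')).Reachable s u ∧ ¬ (openGraph (ωᶜ ∩ E')).Reachable s u) then (1 : ℝ) else 0) +
          (if ¬ ((openGraph (ω ∩ E')).Reachable s u ∧ (openGraph (ωᶜ ∩ E')).Reachable s u) then (1 : ℝ) else 0)) := by
      rw [Finset.prod_add, Finset.mul_sum]
      refine Finset.sum_congr rfl fun A hA => ?_
      rw [Finset.prod_boole, Finset.prod_boole]
      have hsplit : ω ∈ tset E' s (R ∪ ↑(N \ A)) ((X \ {x}) ∪ ↑A) ↔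
          ω ∈ tset E' s R (X \ {x}) ∧
            (∀ u ∈ A, ¬ (openGraph (ω ∩ E')).Reachable s u ∧ ¬ (openGraph (ωᶜ ∩ E')).Reachable s u) ∧
            (∀ u ∈ N \ A, ¬ ((openGraph (ω ∩ E')).Reachable s u ∧ (openGraph (ωᶜ ∩ E')).Reachable s u)) := by
        rw [mem_tset, mem_tset]
        constructor
        · rintro ⟨hR, hX⟩
          exact ⟨⟨fun r hr => hR r (Or.inl hr), fun y hy => hX y (Or.inl hy)⟩, fun u hu => hX u (Or.inr (Finset.mem_coe.2 hu)),
            fun u hu => hR u (Or.inr (Finset.mem_coe.2 hu))⟩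
        · rintro ⟨⟨hR, hX⟩, hA', hNA⟩
          refine ⟨fun r hr => ?_, fun y hy => ?_⟩
          · rcases hr with hr | hr
            · exact hR r hr
            · exact hNA r (Finset.mem_coe.1 hr)
          · rcases hy with hy | hy
            · exact hX y hy
            · exact hA' y (Finset.mem_coe.1 hy)
      by_cases c0 : ω ∈ tset E' s R (X \ {x})
      · by_cases c1 : ∀ u ∈ A, ¬ (openGraph (ω ∩ E')).Reachable s u ∧ ¬ (openGraph (ωᶜ ∩ E')).Reachable s u
        · by_cases c2 : ∀ u ∈ N \ A, ¬ ((openGraph (ω ∩ E')).Reachable s u ∧ (openGraph (ωᶜ ∩ E')).Reachable s u)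
          · rw [if_pos (hsplit.2 ⟨c0, c1, c2⟩), if_pos c0, if_pos c1, if_pos c2]; ring
          · rw [if_neg (fun h' => c2 (hsplit.1 h').2.2), if_pos c0, if_pos c1, if_neg c2]; ring
        · rw [if_neg (fun h' => c1 (hsplit.1 h').2.1), if_pos c0, if_neg c1]; ring
      · rw [if_neg (fun h' => c0 (hsplit.1 h').1), if_neg c0]; ring
    rw [lhs, rhs]
    congr 1
    exact Finset.prod_congr rfl fun u _ => ite_add_ite_eq _ _
  rw [step2, Finset.mul_sum]
  have h2 : (2 : ℝ) ^ N.card ≠ 0 := pow_ne_zero _ two_ne_zero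
  have e3 : ∀ A ∈ N.powerset, (2 : ℝ) ^ N.card * (((2 : ℝ) ^ N.card)⁻¹ * ∑ ω, h A ω) = ∑ ω, h A ω := fun A _ => by
    field_simp
  rw [Finset.sum_congr rfl e3, Finset.sum_comm, Finset.sum_congr rfl fun ω _ => step3 ω, Finset.sum_comm]
  refine Finset.sum_congr rfl fun A _ => ?_
  rw [tsum, Finset.sum_ite_mem, Finset.univ_inter]

/-- **BIC on all edge subsets implies every `T_E(R,X) ≥ 0`** (MEMO-gen31 §1c PROPOSITION): if the bicluster-avoidance sums
`T_{E'}(R',∅)` are nonnegative for every `E' ⊆ E` and every `R' ∌ s`, then `T_E(R,X) ≥ 0` for every `R ∌ s` and every `X`.  Induction on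
`|E|·(|V|+1) + |X|` by peeling a sink. [this work] -/
theorem tsum_nonneg_of_bic (F G : Set (Sym2 V) → ℝ) (E : Set (Sym2 V)) (s : V)
    (hBIC : ∀ E' : Set (Sym2 V), E' ⊆ E → ∀ R : Set V, s ∉ R → 0 ≤ tsum F G E' s R ∅) :
    ∀ (R X : Set V), s ∉ R → 0 ≤ tsum F G E s R X := by
  suffices H : ∀ n : ℕ, ∀ E' : Set (Sym2 V), E' ⊆ E → ∀ R X : Set V, s ∉ R →
      E'.ncard * (Fintype.card V + 1) + X.ncard ≤ n → 0 ≤ tsum F G E' s R X from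
    fun R X hR => H _ E subset_rfl R X hR le_rfl
  intro n
  induction n with
  | zero =>
    intro E' hE' R X hR hμ
    have hX : X = ∅ := by
      have : X.ncard = 0 := by omega
      exact (Set.ncard_eq_zero (Set.toFinite X)).1 this
    subst hX
    exact hBIC E' hE' R hR
  | succ n ih =>
    intro E' hE' R X hR hμ
    by_cases hsX : s ∈ X
    · rw [tsum_eq_zero_of_mem_X F G E' s R hsX]
    by_cases hXe : X = ∅
    · subst hXe; exact hBIC E' hE' R hR
    obtain ⟨x, hxX⟩ := Set.nonempty_iff_ne_empty.2 hXe
    have hxs : x ≠ s := fun h => hsX (h ▸ hxX)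
    have hpeel := peel_identity F G E' s x hxs R X hxX
    set N := Finset.univ.filter fun u => s(x, u) ∈ E' ∧ u ≠ x with hN
    have hpos : (0 : ℝ) < (2 : ℝ) ^ N.card := pow_pos two_pos _
    suffices hsum : 0 ≤ ∑ A ∈ N.powerset, tsum F G (E' \ {e | x ∈ e}) s (R ∪ ↑(N \ A)) ((X \ {x}) ∪ ↑A) by
      rw [← hpeel] at hsum
      exact le_of_mul_le_mul_left (by rw [mul_zero]; exact hsum) hpos
    refine Finset.sum_nonneg fun A hA => ?_
    by_cases hsR : s ∈ R ∪ ↑(N \ A)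
    · rw [tsum_eq_zero_of_mem_R F G _ s _ hsR]
    refine ih (E' \ {e | x ∈ e}) (fun e he => hE' he.1) _ _ hsR ?_
    have hE'' : E' \ {e | x ∈ e} ⊆ E' := fun e he => he.1
    have hXfin := Set.toFinite X
    have hX' : ((X \ {x}) ∪ ↑A).ncard ≤ Fintype.card V := by
      rw [← Nat.card_eq_fintype_card, ← Set.ncard_univ]
      exact Set.ncard_le_ncard (Set.subset_univ _)
    have hXx : (X \ {x}).ncard + 1 = X.ncard := Set.ncard_sdiff_singleton_add_one hxX hXfin
    by_cases hNe : N = ∅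
    · -- no edges at x: E'' may equal E', but X shrinks and A = ∅
      have hA0 : A = ∅ := Finset.subset_empty.1 (hNe ▸ Finset.mem_powerset.1 hA)
      subst hA0
      have h1 : (E' \ {e | x ∈ e}).ncard ≤ E'.ncard := Set.ncard_le_ncard hE'' (Set.toFinite E')
      have h2 : ((X \ {x}) ∪ ↑(∅ : Finset V)).ncard = (X \ {x}).ncard := by simp
      rw [h2]
      have := Nat.mul_le_mul_right (Fintype.card V + 1) h1
      omega
    · -- an edge at x disappears
      obtain ⟨u, hu⟩ := Finset.nonempty_iff_ne_empty.2 hNe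
      rw [hN, Finset.mem_filter] at hu
      have hlt : (E' \ {e | x ∈ e}).ncard < E'.ncard :=
        Set.ncard_lt_ncard ⟨hE'', fun h => (h hu.2.1).2 (Sym2.mem_mk_left x u)⟩ (Set.toFinite E')
      have := Nat.mul_le_mul_right (Fintype.card V + 1) (Nat.succ_le_of_lt hlt)
      rw [Nat.succ_mul] at this
      omega

end Peel

section Corollary

variable {V : Type*} [Fintype V]

/-- **CONJECTURE BIC ⟹ the antithetic BHK inequality with sinks** (MEMO-gen31 §1c), without the `Peel` bookkeeping: if for every `E' ⊆ E` and every
`R ∌ s` the bicluster-avoidance sum `Σ_{ω : no r ∈ R joined to s in both ω∩E' and ωᶜ∩E'} Δ_{E'}(ω)` is nonnegative, then for every sink set `X`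
`0 ≤ Σ_{ω : no x ∈ X joined to s in ω∩E or in ωᶜ∩E} Δ_E(ω)`, where `Δ_E(ω) = (F(C_s(ω∩E)) − F(C_s(ωᶜ∩E)))(G(C_s(ω∩E)) − G(C_s(ωᶜ∩E)))` for ANY
`F, G`. [this work] -/
theorem sc_nonneg_of_bic (F G : Set (Sym2 V) → ℝ) (E : Set (Sym2 V)) (s : V)
    (hBIC : ∀ E' : Set (Sym2 V), E' ⊆ E → ∀ R : Set V, s ∉ R →
      0 ≤ ∑ ω ∈ Finset.univ.filter (fun ω : Set (Sym2 V) =>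
          ∀ r ∈ R, ¬ ((openGraph (ω ∩ E')).Reachable s r ∧ (openGraph (ωᶜ ∩ E')).Reachable s r)),
        (F (openEdgeCluster (ω ∩ E') s) - F (openEdgeCluster (ωᶜ ∩ E') s)) *
          (G (openEdgeCluster (ω ∩ E') s) - G (openEdgeCluster (ωᶜ ∩ E') s)))
    (X : Set V) :
    0 ≤ ∑ ω ∈ Finset.univ.filter (fun ω : Set (Sym2 V) =>
        ∀ x ∈ X, ¬ (openGraph (ω ∩ E)).Reachable s x ∧ ¬ (openGraph (ωᶜ ∩ E)).Reachable s x),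
      (F (openEdgeCluster (ω ∩ E) s) - F (openEdgeCluster (ωᶜ ∩ E) s)) *
        (G (openEdgeCluster (ω ∩ E) s) - G (openEdgeCluster (ωᶜ ∩ E) s)) := by
  have hBIC' : ∀ E' : Set (Sym2 V), E' ⊆ E → ∀ R : Set V, s ∉ R → 0 ≤ Peel.tsum F G E' s R ∅ := by
    intro E' hE' R hR
    have hset : Peel.tset E' s R ∅ = Finset.univ.filter (fun ω : Set (Sym2 V) =>
        ∀ r ∈ R, ¬ ((openGraph (ω ∩ E')).Reachable s r ∧ (openGraph (ωᶜ ∩ E')).Reachable s r)) := by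
      ext ω
      simp [Peel.mem_tset]
    unfold Peel.tsum
    rw [hset]
    exact hBIC E' hE' R hR
  have h := Peel.tsum_nonneg_of_bic F G E s hBIC' ∅ X (Set.notMem_empty s)
  have hset2 : Peel.tset E s ∅ X = Finset.univ.filter (fun ω : Set (Sym2 V) =>
      ∀ x ∈ X, ¬ (openGraph (ω ∩ E)).Reachable s x ∧ ¬ (openGraph (ωᶜ ∩ E)).Reachable s x) := by
    ext ω
    simp [Peel.mem_tset]
  unfold Peel.tsum at h
  rw [hset2] at h
  exact h

end Corollary

end Antithetic

end Summit.CriticalPhenomena.PercolationContinuityZ3.Theorems
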